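import Literature.MathematicalPhysics.QuantumFieldTheory.Balaban1983to89.B6Eq230GaussianRoute

/-!
# `Balaban1983to89.B6Eq2117FaddeevPopov` — T. Bałaban, *Propagators and renormalization transformations for lattice
# gauge theories. II*, Commun. Math. Phys. **96** (1984) 223–250 [Balaban1984PropagatorsII], Sect. C (2.116)–(2.118)
# p. 243: the FADDEEV–POPOV REPLACEMENT of the exponential gauge-fixing term by `δ_R(R∂*A)` inside the fibre integral of
# (2.116), the factor **(2.117) `exp[−½‖∂H_jB‖²]` "by (1.47) and (1.64)"**, and *"Thus both factors are equal and in
# fact the quadratic forms are equal to ⟨B, Δ_jB⟩"* — PROVED over the abstract carriers of `…B6Eq295` §4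

statement-level skeleton of published theorems with citation tags; proofs where landed; nothing here is a claim about the Yang–Mills mass gap

PDF held: `paper:balaban1984-cmp96-propagators-rt-ii` (journal page = PDF page + 222); p. 243 read AS IMAGE on the ×2
render `run/shared/lean/pub/pub-balaban/b2b-balaban-ref1/pages/1984-cmp96-propagators-rt-II/…-p021-x2.png`, and, for
*"(1.47) and (1.64)"* of [4] = [Balaban1984PropagatorsI], pp. 26, 29 on `…/1984-cmp95-propagators-rt-I/…-p010, -p013-x2.png`,
by this seat (2026-08-21).

CITATION HEADER (lean-in-tree rule).  WHAT IS REPRODUCED: the member (2.116) ⇒ (2.117) ⇒ (2.118)-identification of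
lit-balaban SKELETON row **B6.Eq2.111** ((2.111)–(2.117) pp. 242–243; cell note of record (ROWS-B6 v1.19, owner r03):
*"(2.117) Faddeev–Popov replacement and 'H_j(exp-gauge) = H_j(δ-gauge)' located → B5 (1.47)/(1.64)"* — i.e. NOT typed
until now), which is at the same time the HYPOTHESIS `h2118 : ⟨H_jB,(Δ−∂P_j∂*)H_jB⟩ = ⟨B,Δ_jB⟩` under which row
**B6.Eq2.119** (`…B6GaussianIdentity2119.inner_integral_2119` / `eq2119`, this seat gen 1) and row **B6.Eq2.129**
(`…B6Repr2129.eq2129`, gen 2) were proved.  PHASE-2 seat p22 (gen 5); owner r03, referee ref-4.  IMPORTS, restating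
nothing: `…B6Eq230GaussianRoute` (gen 4: the Faddeev–Popov change of variables (2.29) with its constant Jacobian, `Z_pos`)
→ `…B6Eq228FaddeevPopov` (`R_dstar_gauge`, `inner_dstar_D_of_slice`, `existsUnique_229`) → `…B5ChangeOfGauge123`
(gen 1: `integral_slice_orbit`, `jacobian_pos` — the (1.23)/(1.46) engine of [4]) → `…B6Eq295` (`eq2116`).

PRINT (p. 243 [PDF 21], verbatim).  *"In the last integral above we make the translation A → A + H_jB. The operator
H_j may be different from the operator defined in Sect. D of [4], because there is the exponential gauge fixing term
instead of the δ-function, but we will prove later that they are equal. … Let us notice also that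
exp[−½⟨H_jB,(Δ−∂P_j∂*)H_jB⟩] = Z̃_j⁻¹∫dAδ(Q_jA − B)exp[−½⟨A,(Δ−∂P_j∂*)A⟩], (2.116) and that in the last integral
we may replace the exponential gauge fixing term by the δ-function δ_R(R∂*A) using the Faddeev-Popov procedure. Then
this integral gives the factor exp[−½‖∂H_jB‖²] (2.117) by (1.47) and (1.64). Thus both factors are equal and in fact
the quadratic forms are equal to ⟨B, Δ_jB⟩ given by (1.66) and satisfying (1.67): γ₀‖∂₁B‖² ≦ ⟨B,Δ_jB⟩ ≦ γ₁‖∂₁B‖².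
(2.118)"*.  [4] p. 26: *"We may introduce this gauge from the beginning using the equation
∫dλδ(Q′_kλ)|det(Δ↾_{N(Q′_k)})|δ_R(∂*A − Δλ) = 1. (1.46) We have to calculate the integral
((ST)^ke^{−S})(B) = z′^{(k)}|det(Δ↾_{N(Q_k)})|∫dAδ(B − Q_kA)δ_R(∂*A)exp(−½⟨∂A,∂A⟩). (1.47) … [H_kB] is equal to a
configuration A on T_η minimizing the form ½⟨∂A,∂A⟩ under the conditions Q_kA = B, R∂*A = 0"*; p. 29: *"Q_kH_kB = B,
R∂*H_kB = 0, H_kB is a minimum of ½⟨∂A,∂A⟩ on the hyperplane {A : Q_kA = B, R∂*A = 0}, which means that ⟨∂A′,∂H_kB⟩ = 0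
on the subspace {A′ : Q_kA′ = 0, R∂*A′ = 0}. Let us now come back to the integral (1.47). We make the translation
A = A′ + H_kB and using the above properties of H_kB, we get ((ST)^ke^{−S})(B) = Z_k exp(−½⟨∂H_kB,∂H_kB⟩). (1.64)
The action Δ_k is thus defined by ⟨B,Δ_kB⟩ = ⟨∂H_kB,∂H_kB⟩. (1.65)"*.

TYPING (the convention of `…B6Eq295` §4 / `…B6Eq230GaussianRoute`, every hypothesis displayed).  `M` = Δ − ∂P_j∂* with
its form `⟨A,MA⟩ = ‖∂A‖² + ⟨∂*A,R∂*A⟩` (`hformM`; `curl` = ∂ on vector fields, `dstar` = ∂*, `Rp` = R = the orthogonal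
projection onto `ΔN(Q′) = range D`, (2.10)); the gauge group `N(Q′)` (of order j) = `N` acting by `A ↦ A − dN λ` with
`∂(∂λ) = 0` (`hcurl`), `Q_j∂λ = 0` (`hQ`), `∂*∂λ = Δλ = Dλ` (`hD`).  The fibre integral `∫dAδ(Q_jA − B)F(A)` is
`∫ F(ιn + h) dμ′(n)` (`ι` a linear parametrisation of `{Q_jA = 0}`, `h` a point of the fibre, `μ′` an additive Haar =
Lebesgue measure), the doubly constrained integral `∫dAδ(Q_jA − B)δ_R(R∂*A)F(A)` of (1.47) is `∫ F(σm + h) dμS(m)` (`σ`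
parametrising the slice directions `{Q_j· = 0, R∂*· = 0}`, `h` in the slice).  *"The Faddeev-Popov procedure"* inside
the fibre = slice ⊕ gauge-orbit coordinates `e : S × N ≃ N′`, `ι(e(m,λ′)) = σm − ∂λ′` (they EXIST because
`δ_R(R∂*A + Δλ′)` has exactly one zero, `existsUnique_229`, and `Q_j∂λ′ = 0` keeps the orbit in the fibre:
`exists_fibreSliceEquiv`), with the constant Jacobian `c = addHaarScalarFactor((μS ⊗ ν)∘e⁻¹, μ′) > 0` = the
`|det(Δ↾N(Q′))|`-type unit of (1.46)/(2.29) in the chosen flat normalisations; it CANCELS against the `B = 0`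
normalisation, as `Z_k`/`Z̃_j` do in print.  `H_j^{exp}B` (the translation of (2.113)) enters through
`(Δ−∂P_j∂*)H_jB ⊥ {Q_jA = 0}` (`hcritε`, as in `…B6Eq295.eq2116`), `H_j^{δ}B` (Sect. D of [4]) through `R∂*H_jB = 0` and
*"⟨∂A′,∂H_kB⟩ = 0 on the subspace {Q_kA′ = 0, R∂*A′ = 0}"* (`hcritδ`).

CONTENTS (all theorems; no definitions; standard axioms).
§1 `formM_gauge` (the form at a gauge transform of a slice configuration: `‖∂A₀‖² + ‖Δλ′‖²`).
§2 `fp_fibre` ((1.46)/(2.29) inside the fibre: one change of variables, constant Jacobian), **`fp_replacement`**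
   (*"we may replace the exponential gauge fixing term by the δ-function δ_R(R∂*A) using the Faddeev-Popov procedure"*:
   `c·∫dAδ(Q_jA−B)e^{−½⟨A,MA⟩} = ∫dAδ(Q_jA−B)δ_R(R∂*A)e^{−½‖∂A‖²} · Z′`, the constant independent of `B`),
   **`eq2117`** ((1.64): the translation `A = A′ + H_jB` gives the factor `exp[−½‖∂H_jB‖²]`), **`eq2116_fp`** (the
   (2.116) integral equals `e^{−½‖∂H_jB‖²}·Z̃_j` — the Jacobian cancelled against `B = 0`).
§3 **`factors_eq`** / **`forms_eq`** (*"Thus both factors are equal and in fact the quadratic forms are equal"*: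
   `⟨H_j^{exp}B,(Δ−∂P_j∂*)H_j^{exp}B⟩ = ‖∂H_j^{δ}B‖²`, given `Z̃_j ≠ 0`), **`translations_eq`** (*"we will prove later that
   they are equal"*: `H_j^{exp}B = H_j^{δ}B` from the equal forms and definiteness on `{Q_jA = 0}` — the Gaussian route;
   the algebraic route is `…B6Eq2130.minimisers_coincide`), **`h2118_of_fp`** (the hypothesis `h2118` of
   `…B6GaussianIdentity2119.eq2119` with `⟨B,Δ_jB⟩ := ‖∂H_jB‖²` (1.65), DISCHARGED).
§4 `exists_fibreSliceEquiv` (the coordinates exist), `Ztilde_pos` (`Z̃_j > 0` from positivity on `{Q_jA = 0}`),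
   **`forms_eq_of_fp`** / **`h2118_of_fp_ker`** (the same with the fibre = `ker Q_j` itself, Haar measures chosen internally:
   hypotheses = the printed structure + `Δ` injective on `N(Q′)` ((2.11)) + `Z̃_j ≠ 0`).
HONEST SCOPE: abstract carriers as in the sibling files ((2.118)'s bounds are [4] (1.67) = `…B5.Bounds167`, not re-derived;
the identification of the carriers with the lattice objects of (2.5)–(2.20)/(2.89)–(2.97) is not made here); value =
kernel certificate of the displayed computation, NOT summit progress.  Unit `lit-balaban-p22` (gen 5), HOME
`run/shared/lean/pub/lit-balaban/`.
-/

noncomputable section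

open MeasureTheory
open scoped InnerProductSpace

namespace Literature.MathematicalPhysics.QuantumFieldTheory.Balaban1983to89.B6Eq2117FaddeevPopov

open B6Eq228FaddeevPopov

/-! ## §1  The form `⟨A,(Δ − ∂P_j∂*)A⟩` along a gauge orbit through the slice `{R∂*A = 0}` -/

section Algebra

variable {V A T N : Type*} [NormedAddCommGroup V] [InnerProductSpace ℝ V] [NormedAddCommGroup A]
  [InnerProductSpace ℝ A] [NormedAddCommGroup T] [InnerProductSpace ℝ T] [AddCommGroup N] [Module ℝ N]

/-- The exponential gauge-fixing form `⟨A,(Δ−∂P_j∂*)A⟩ = ‖∂A‖² + ⟨∂*A,R∂*A⟩` at the gauge transform `A₀ − ∂λ′` of a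
configuration `A₀` on the support of `δ_R(R∂*A₀)`: `= ‖∂A₀‖² + ‖Δλ′‖²` (`∂∂λ′ = 0`, `R∂*(A₀ − ∂λ′) = −Δλ′`,
`⟨∂*A₀, Δλ′⟩ = ⟨R∂*A₀, Δλ′⟩ = 0`) — the pointwise content of the Faddeev–Popov replacement in (2.116).
[cite: Balaban1984PropagatorsII, (2.116)–(2.117) p.243] -/
theorem formM_gauge (M : A →ₗ[ℝ] A) (curl : A →ₗ[ℝ] T) (dstar : A →ₗ[ℝ] V) (Rp : V →ₗ[ℝ] V)
    (D : N →ₗ[ℝ] V) (dN : N →ₗ[ℝ] A) (K : Submodule ℝ V) [K.HasOrthogonalProjection]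
    (hK : LinearMap.range D = K) (hR : ∀ g, Rp g = K.starProjection g)
    (hformM : ∀ v, ⟪v, M v⟫_ℝ = ‖curl v‖ ^ 2 + ⟪dstar v, Rp (dstar v)⟫_ℝ)
    (hcurl : ∀ l, curl (dN l) = 0) (hD : ∀ l, dstar (dN l) = D l) {v : A} (hs : Rp (dstar v) = 0)
    (l : N) : ⟪v - dN l, M (v - dN l)⟫_ℝ = ‖curl v‖ ^ 2 + ‖D l‖ ^ 2 := by
  have h1 : curl (v - dN l) = curl v := by rw [map_sub, hcurl, sub_zero]
  have h3 : dstar (v - dN l) = dstar v - D l := by rw [map_sub, hD]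
  have h4 : Rp (dstar (v - dN l)) = -D l := by rw [R_dstar_gauge D K hK Rp hR dstar dN hD, hs, zero_sub]
  rw [hformM, h1, h4, h3, inner_neg_right, inner_sub_left, real_inner_self_eq_norm_sq,
    inner_dstar_D_of_slice D K hK Rp hR hs l]
  ring

/-- On the slice `{R∂*A = 0}` the exponential gauge-fixing form IS `‖∂A‖²`: `⟨A,(Δ−∂P_j∂*)A⟩ = ‖∂A‖²` for `R∂*A = 0`
(so for `H_j^{δ}B` of Sect. D of [4] the two quadratic forms of p. 243 are literally the same number).
[cite: Balaban1984PropagatorsII, (2.117) p.243] -/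
theorem formM_of_slice (M : A →ₗ[ℝ] A) (curl : A →ₗ[ℝ] T) (dstar : A →ₗ[ℝ] V) (Rp : V →ₗ[ℝ] V)
    (hformM : ∀ v, ⟪v, M v⟫_ℝ = ‖curl v‖ ^ 2 + ⟪dstar v, Rp (dstar v)⟫_ℝ) {v : A} (hs : Rp (dstar v) = 0) :
    ⟪v, M v⟫_ℝ = ‖curl v‖ ^ 2 := by
  rw [hformM, hs, inner_zero_right, add_zero]

end Algebra

/-! ## §2  The Faddeev–Popov procedure inside the fibre `{Q_jA = B}` and the factor (2.117) -/

section Fibre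

variable {V A W T S N N' : Type*} [NormedAddCommGroup V] [InnerProductSpace ℝ V]
  [NormedAddCommGroup A] [InnerProductSpace ℝ A] [AddCommGroup W] [Module ℝ W]
  [NormedAddCommGroup T] [InnerProductSpace ℝ T]
  [NormedAddCommGroup S] [NormedSpace ℝ S] [FiniteDimensional ℝ S] [MeasurableSpace S] [BorelSpace S]
  [NormedAddCommGroup N] [NormedSpace ℝ N] [FiniteDimensional ℝ N] [MeasurableSpace N] [BorelSpace N]
  [NormedAddCommGroup N'] [NormedSpace ℝ N'] [FiniteDimensional ℝ N'] [MeasurableSpace N'] [BorelSpace N']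

/-- **(1.46)/(2.29) inside the fibre `{Q_jA = B}` — "the Faddeev-Popov procedure" as ONE change of variables.**  With
slice ⊕ gauge-orbit coordinates `e : S × N ≃ N′` of the fibre directions, `ι(e(m,λ′)) = σm − ∂λ′`, and additive Haar
(Lebesgue) measures: `∫∫ Φ(σm + h − ∂λ′) dμS dν = c · ∫dAδ(Q_jA − B)Φ(A)` (`= c·∫Φ(ιn + h)dμ′`), `c =
addHaarScalarFactor((μS ⊗ ν)∘e⁻¹, μ′) > 0` the constant Jacobian (the `|det(Δ↾N(Q′))|`-unit of (1.46) in the chosen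
normalisations; `…B5ChangeOfGauge123.integral_slice_orbit`). [cite: Balaban1984PropagatorsII, (2.116)–(2.117) p.243] -/
theorem fp_fibre (μS : Measure S) (ν : Measure N) (μ' : Measure N') [μS.IsAddHaarMeasure] [ν.IsAddHaarMeasure]
    [μ'.IsAddHaarMeasure] (e : (S × N) ≃L[ℝ] N') (ι : N' →ₗ[ℝ] A) (σ : S → A) (dN : N →ₗ[ℝ] A)
    (he : ∀ m l, ι (e (m, l)) = σ m - dN l) (h : A) (Φ : A → ℝ) :
    ∫ p, Φ (σ p.1 + h - dN p.2) ∂(μS.prod ν) =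
      (Measure.addHaarScalarFactor ((μS.prod ν).map e) μ' : ℝ) * ∫ n, Φ (ι n + h) ∂μ' := by
  have H := B5ChangeOfGauge123.integral_slice_orbit μS ν μ' e h ι (fun m => σ m + h) dN
    (fun m l => by rw [he]; abel) Φ
  rw [smul_eq_mul] at H
  rw [H]
  congr 1
  refine integral_congr_ae (ae_of_all _ fun n => ?_)
  show Φ (h + ι n) = Φ (ι n + h)
  rw [add_comm]

/-- **"in the last integral we may replace the exponential gauge fixing term by the δ-function δ_R(R∂*A) using the
Faddeev-Popov procedure"** (p. 243): for a base point `h` of the fibre lying in the slice (`R∂*h = 0`, e.g. `h = H_j^{δ}B`),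
`c · ∫dAδ(Q_jA − B) e^{−½⟨A,(Δ−∂P_j∂*)A⟩} = (∫dAδ(Q_jA − B)δ_R(R∂*A) e^{−½‖∂A‖²}) · Z′`,
`Z′ = ∫dλ′δ(Q′λ′)e^{−½‖Δλ′‖²}` — insert (2.29), change the order, gauge transformation `A → A − ∂λ′` (`Q_jA` and `‖∂A‖²`
invariant, `R∂*A ↦ R∂*A − Δλ′`), change the order again; the constant `Z′/c` does not depend on `B`.  No integrability
hypothesis (the integrand factorises slice × orbit). [cite: Balaban1984PropagatorsII, (2.116)–(2.117) p.243] -/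
theorem fp_replacement (μS : Measure S) (ν : Measure N) (μ' : Measure N') [μS.IsAddHaarMeasure]
    [ν.IsAddHaarMeasure] [μ'.IsAddHaarMeasure] (e : (S × N) ≃L[ℝ] N') (ι : N' →ₗ[ℝ] A) (σ : S → A)
    (dN : N →ₗ[ℝ] A) (he : ∀ m l, ι (e (m, l)) = σ m - dN l) (M : A →ₗ[ℝ] A) (curl : A →ₗ[ℝ] T)
    (dstar : A →ₗ[ℝ] V) (Rp : V →ₗ[ℝ] V) (D : N →ₗ[ℝ] V) (K : Submodule ℝ V) [K.HasOrthogonalProjection]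
    (hK : LinearMap.range D = K) (hR : ∀ g, Rp g = K.starProjection g)
    (hformM : ∀ v, ⟪v, M v⟫_ℝ = ‖curl v‖ ^ 2 + ⟪dstar v, Rp (dstar v)⟫_ℝ)
    (hcurl : ∀ l, curl (dN l) = 0) (hD : ∀ l, dstar (dN l) = D l) (hσ : ∀ m, Rp (dstar (σ m)) = 0)
    {h : A} (hh : Rp (dstar h) = 0) :
    (Measure.addHaarScalarFactor ((μS.prod ν).map e) μ' : ℝ) *
        ∫ n, Real.exp (-(1 / 2) * ⟪ι n + h, M (ι n + h)⟫_ℝ) ∂μ' =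
      (∫ m, Real.exp (-(1 / 2) * ‖curl (σ m + h)‖ ^ 2) ∂μS) * ∫ l, Real.exp (-(1 / 2) * ‖D l‖ ^ 2) ∂ν := by
  rw [← fp_fibre μS ν μ' e ι σ dN he h (fun v => Real.exp (-(1 / 2) * ⟪v, M v⟫_ℝ))]
  have hpt : ∀ p : S × N, Real.exp (-(1 / 2) * ⟪σ p.1 + h - dN p.2, M (σ p.1 + h - dN p.2)⟫_ℝ) =
      Real.exp (-(1 / 2) * ‖curl (σ p.1 + h)‖ ^ 2) * Real.exp (-(1 / 2) * ‖D p.2‖ ^ 2) := by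
    intro p
    have hs : Rp (dstar (σ p.1 + h)) = 0 := by rw [map_add, map_add, hσ, hh, add_zero]
    rw [formM_gauge M curl dstar Rp D dN K hK hR hformM hcurl hD hs p.2, ← Real.exp_add]
    congr 1; ring
  simp_rw [hpt]
  exact integral_prod_mul (fun m : S => Real.exp (-(1 / 2) * ‖curl (σ m + h)‖ ^ 2))
    (fun l : N => Real.exp (-(1 / 2) * ‖D l‖ ^ 2))

omit [NormedAddCommGroup S] [NormedSpace ℝ S] [FiniteDimensional ℝ S] [BorelSpace S] in
/-- **(2.117) "by (1.47) and (1.64)"** — [4] p. 29: *"We make the translation A = A′ + H_kB and using the above properties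
of H_kB* [`⟨∂A′,∂H_kB⟩ = 0` on `{Q_kA′ = 0, R∂*A′ = 0}`] *we get ((ST)^ke^{−S})(B) = Z_k exp(−½⟨∂H_kB,∂H_kB⟩). (1.64)"*:
`∫dAδ(Q_jA − B)δ_R(R∂*A) e^{−½‖∂A‖²} = exp[−½‖∂H_jB‖²] · ∫dAδ(Q_jA)δ_R(R∂*A) e^{−½‖∂A‖²}` (any measure on the slice
parameters; Pythagoras pointwise). [cite: Balaban1984PropagatorsII, (2.117) p.243] -/
theorem eq2117 (μS : Measure S) (curl : A →ₗ[ℝ] T) (σ : S → A) {h : A}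
    (hcrit : ∀ m, ⟪curl (σ m), curl h⟫_ℝ = 0) :
    ∫ m, Real.exp (-(1 / 2) * ‖curl (σ m + h)‖ ^ 2) ∂μS =
      Real.exp (-(1 / 2) * ‖curl h‖ ^ 2) * ∫ m, Real.exp (-(1 / 2) * ‖curl (σ m)‖ ^ 2) ∂μS := by
  rw [← integral_const_mul]
  refine integral_congr_ae (ae_of_all _ fun m => ?_)
  show Real.exp (-(1 / 2) * ‖curl (σ m + h)‖ ^ 2) =
    Real.exp (-(1 / 2) * ‖curl h‖ ^ 2) * Real.exp (-(1 / 2) * ‖curl (σ m)‖ ^ 2)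
  rw [map_add, norm_add_sq_real, hcrit m, mul_zero, add_zero, ← Real.exp_add]
  congr 1; ring

/-- **(2.116) = (2.117): the fibre integral of (2.116) computed by the Faddeev–Popov route.**  For `H_j^{δ}B =: h` in the
slice (`R∂*h = 0`) with `∂h ⊥ ∂(slice directions)`:
`∫dAδ(Q_jA − B) e^{−½⟨A,(Δ−∂P_j∂*)A⟩} = exp[−½‖∂H_jB‖²] · Z̃_j`, `Z̃_j = ∫dAδ(Q_jA) e^{−½⟨A,(Δ−∂P_j∂*)A⟩}` — the
constant `Z′/c` of `fp_replacement` cancels against the case `B = 0` (*"Then this integral gives the factor exp[−½‖∂H_jB‖²]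
(2.117)"*). [cite: Balaban1984PropagatorsII, (2.116)–(2.117) p.243] -/
theorem eq2116_fp (μS : Measure S) (ν : Measure N) (μ' : Measure N') [μS.IsAddHaarMeasure]
    [ν.IsAddHaarMeasure] [μ'.IsAddHaarMeasure] (e : (S × N) ≃L[ℝ] N') (ι : N' →ₗ[ℝ] A) (σ : S → A)
    (dN : N →ₗ[ℝ] A) (he : ∀ m l, ι (e (m, l)) = σ m - dN l) (M : A →ₗ[ℝ] A) (curl : A →ₗ[ℝ] T)
    (dstar : A →ₗ[ℝ] V) (Rp : V →ₗ[ℝ] V) (D : N →ₗ[ℝ] V) (K : Submodule ℝ V) [K.HasOrthogonalProjection]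
    (hK : LinearMap.range D = K) (hR : ∀ g, Rp g = K.starProjection g)
    (hformM : ∀ v, ⟪v, M v⟫_ℝ = ‖curl v‖ ^ 2 + ⟪dstar v, Rp (dstar v)⟫_ℝ)
    (hcurl : ∀ l, curl (dN l) = 0) (hD : ∀ l, dstar (dN l) = D l) (hσ : ∀ m, Rp (dstar (σ m)) = 0)
    {h : A} (hh : Rp (dstar h) = 0) (hcrit : ∀ m, ⟪curl (σ m), curl h⟫_ℝ = 0) :
    ∫ n, Real.exp (-(1 / 2) * ⟪ι n + h, M (ι n + h)⟫_ℝ) ∂μ' =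
      Real.exp (-(1 / 2) * ‖curl h‖ ^ 2) * ∫ n, Real.exp (-(1 / 2) * ⟪ι n, M (ι n)⟫_ℝ) ∂μ' := by
  set c : ℝ := (Measure.addHaarScalarFactor ((μS.prod ν).map e) μ' : ℝ) with hc
  have hcpos : 0 < c := by rw [hc]; exact_mod_cast B5ChangeOfGauge123.jacobian_pos μS ν μ' e
  have h1 := fp_replacement μS ν μ' e ι σ dN he M curl dstar Rp D K hK hR hformM hcurl hD hσ hh
  have h0 := fp_replacement μS ν μ' e ι σ dN he M curl dstar Rp D K hK hR hformM hcurl hD hσ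
    (h := (0 : A)) (by rw [map_zero, map_zero])
  simp only [add_zero] at h0
  rw [← hc] at h1 h0
  rw [eq2117 μS curl σ hcrit] at h1
  apply mul_left_cancel₀ hcpos.ne'
  rw [h1, mul_left_comm, h0]
  ring

/-! ## §3  "Thus both factors are equal and in fact the quadratic forms are equal"; `H_j^{exp} = H_j^{δ}`; `h2118` -/

/-- **"Thus both factors are equal"** (p. 243): the factor `exp[−½⟨H_jB,(Δ−∂P_j∂*)H_jB⟩]` of (2.113)/(2.116) (`hε := H_j^{exp}B`,
the critical configuration of the exponential gauge fixing: `(Δ−∂P_j∂*)hε ⊥ {Q_jA = 0}`, `hcritε`) and the factor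
`exp[−½‖∂H_jB‖²]` of (2.117) (`hδ := H_j^{δ}B` of Sect. D of [4]: `R∂*hδ = 0`, `∂hδ ⊥ ∂(slice)`, `hcritδ`) coincide, both
being `Z̃_j⁻¹ ×` the same fibre integral ((2.116) `…B6Eq295.eq2116`, resp. `eq2116_fp`; the base point of the fibre is moved
from `hε` to `hδ` by a translation of the Haar measure, `hfib`), provided `Z̃_j ≠ 0`.
[cite: Balaban1984PropagatorsII, (2.116)–(2.117) p.243] -/
theorem factors_eq (μS : Measure S) (ν : Measure N) (μ' : Measure N') [μS.IsAddHaarMeasure]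
    [ν.IsAddHaarMeasure] [μ'.IsAddHaarMeasure] (e : (S × N) ≃L[ℝ] N') (ι : N' →ₗ[ℝ] A) (σ : S → A)
    (dN : N →ₗ[ℝ] A) (he : ∀ m l, ι (e (m, l)) = σ m - dN l) (M : A →ₗ[ℝ] A) (Q : A →ₗ[ℝ] W)
    (curl : A →ₗ[ℝ] T) (dstar : A →ₗ[ℝ] V) (Rp : V →ₗ[ℝ] V) (D : N →ₗ[ℝ] V) (K : Submodule ℝ V)
    [K.HasOrthogonalProjection] (hK : LinearMap.range D = K) (hR : ∀ g, Rp g = K.starProjection g)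
    (hM : ∀ x y : A, ⟪M x, y⟫_ℝ = ⟪x, M y⟫_ℝ)
    (hformM : ∀ v, ⟪v, M v⟫_ℝ = ‖curl v‖ ^ 2 + ⟪dstar v, Rp (dstar v)⟫_ℝ) (hι : ∀ n, Q (ι n) = 0)
    (hcurl : ∀ l, curl (dN l) = 0) (hD : ∀ l, dstar (dN l) = D l) (hσ : ∀ m, Rp (dstar (σ m)) = 0)
    {hε hδ : A} (hcritε : ∀ v : A, Q v = 0 → ⟪v, M hε⟫_ℝ = 0) (hδR : Rp (dstar hδ) = 0)
    (hcritδ : ∀ m, ⟪curl (σ m), curl hδ⟫_ℝ = 0) (hfib : ∃ n₀ : N', ι n₀ = hδ - hε)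
    (hZ : ∫ n, Real.exp (-(1 / 2) * ⟪ι n, M (ι n)⟫_ℝ) ∂μ' ≠ 0) :
    Real.exp (-(1 / 2) * ⟪hε, M hε⟫_ℝ) = Real.exp (-(1 / 2) * ‖curl hδ‖ ^ 2) := by
  -- (2.116): the fibre integral with base point `hε`
  have h16 := B6Eq295.eq2116 μ' ι M Q hM hι hε hcritε
  -- (2.117) by Faddeev–Popov: the same fibre integral with base point `hδ`
  have h17 := eq2116_fp μS ν μ' e ι σ dN he M curl dstar Rp D K hK hR hformM hcurl hD hσ hδR hcritδ
  -- the two base points differ by a fibre direction: translate the Haar measure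
  obtain ⟨n₀, hn₀⟩ := hfib
  have hbase : ∫ n, Real.exp (-(1 / 2) * ⟪ι n + hδ, M (ι n + hδ)⟫_ℝ) ∂μ' =
      ∫ n, Real.exp (-(1 / 2) * ⟪ι n + hε, M (ι n + hε)⟫_ℝ) ∂μ' := by
    have hf : (fun n => Real.exp (-(1 / 2) * ⟪ι n + hδ, M (ι n + hδ)⟫_ℝ)) =
        fun n => (fun n' => Real.exp (-(1 / 2) * ⟪ι n' + hε, M (ι n' + hε)⟫_ℝ)) (n₀ + n) := by
      funext n
      have hx : ι (n₀ + n) + hε = ι n + hδ := by rw [map_add, hn₀]; abel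
      simp only [hx]
    rw [hf]
    exact integral_add_left_eq_self (fun n' => Real.exp (-(1 / 2) * ⟪ι n' + hε, M (ι n' + hε)⟫_ℝ)) n₀
  rw [hbase, h16] at h17
  exact mul_right_cancel₀ hZ h17

/-- **"… and in fact the quadratic forms are equal"** (p. 243): `⟨H_j^{exp}B,(Δ−∂P_j∂*)H_j^{exp}B⟩ = ‖∂H_j^{δ}B‖²` (= `⟨B,Δ_jB⟩`
of [4] (1.65)), under the hypotheses of `factors_eq`. [cite: Balaban1984PropagatorsII, (2.117)–(2.118) p.243] -/
theorem forms_eq (μS : Measure S) (ν : Measure N) (μ' : Measure N') [μS.IsAddHaarMeasure]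
    [ν.IsAddHaarMeasure] [μ'.IsAddHaarMeasure] (e : (S × N) ≃L[ℝ] N') (ι : N' →ₗ[ℝ] A) (σ : S → A)
    (dN : N →ₗ[ℝ] A) (he : ∀ m l, ι (e (m, l)) = σ m - dN l) (M : A →ₗ[ℝ] A) (Q : A →ₗ[ℝ] W)
    (curl : A →ₗ[ℝ] T) (dstar : A →ₗ[ℝ] V) (Rp : V →ₗ[ℝ] V) (D : N →ₗ[ℝ] V) (K : Submodule ℝ V)
    [K.HasOrthogonalProjection] (hK : LinearMap.range D = K) (hR : ∀ g, Rp g = K.starProjection g)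
    (hM : ∀ x y : A, ⟪M x, y⟫_ℝ = ⟪x, M y⟫_ℝ)
    (hformM : ∀ v, ⟪v, M v⟫_ℝ = ‖curl v‖ ^ 2 + ⟪dstar v, Rp (dstar v)⟫_ℝ) (hι : ∀ n, Q (ι n) = 0)
    (hcurl : ∀ l, curl (dN l) = 0) (hD : ∀ l, dstar (dN l) = D l) (hσ : ∀ m, Rp (dstar (σ m)) = 0)
    {hε hδ : A} (hcritε : ∀ v : A, Q v = 0 → ⟪v, M hε⟫_ℝ = 0) (hδR : Rp (dstar hδ) = 0)
    (hcritδ : ∀ m, ⟪curl (σ m), curl hδ⟫_ℝ = 0) (hfib : ∃ n₀ : N', ι n₀ = hδ - hε)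
    (hZ : ∫ n, Real.exp (-(1 / 2) * ⟪ι n, M (ι n)⟫_ℝ) ∂μ' ≠ 0) :
    ⟪hε, M hε⟫_ℝ = ‖curl hδ‖ ^ 2 := by
  have h := Real.exp_injective (factors_eq μS ν μ' e ι σ dN he M Q curl dstar Rp D K hK hR hM hformM hι hcurl
    hD hσ hcritε hδR hcritδ hfib hZ)
  linarith

omit [NormedSpace ℝ S] [FiniteDimensional ℝ S] [MeasurableSpace S] [BorelSpace S] in
/-- **"The operator H_j may be different from the operator defined in Sect. D of [4] …, but we will prove later that
they are equal"** (p. 243) — by the Gaussian route: once the quadratic forms agree (`hforms`, = `forms_eq`), `H_j^{δ}B`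
lies on the fibre `{Q_jA = B}` with the minimal value `⟨hδ,(Δ−∂P_j∂*)hδ⟩ = ‖∂hδ‖² = ⟨hε,(Δ−∂P_j∂*)hε⟩` (`formM_of_slice`),
so `H_j^{δ}B = H_j^{exp}B` as soon as the form is definite on `{Q_jA = 0}` (`hdef`; the algebraic route is
`…B6Eq2130.minimisers_coincide`). [cite: Balaban1984PropagatorsII, (2.113)–(2.117) p.243] -/
theorem translations_eq (M : A →ₗ[ℝ] A) (Q : A →ₗ[ℝ] W) (curl : A →ₗ[ℝ] T) (dstar : A →ₗ[ℝ] V)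
    (Rp : V →ₗ[ℝ] V) (hM : ∀ x y : A, ⟪M x, y⟫_ℝ = ⟪x, M y⟫_ℝ)
    (hformM : ∀ v, ⟪v, M v⟫_ℝ = ‖curl v‖ ^ 2 + ⟪dstar v, Rp (dstar v)⟫_ℝ) {hε hδ : A}
    (hQ : Q hδ = Q hε) (hcritε : ∀ v : A, Q v = 0 → ⟪v, M hε⟫_ℝ = 0) (hδR : Rp (dstar hδ) = 0)
    (hforms : ⟪hε, M hε⟫_ℝ = ‖curl hδ‖ ^ 2) (hdef : ∀ v : A, Q v = 0 → ⟪v, M v⟫_ℝ = 0 → v = 0) :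
    hδ = hε := by
  have hv : Q (hδ - hε) = 0 := by rw [map_sub, hQ, sub_self]
  have h1 : ⟪hδ - hε, M hε⟫_ℝ = 0 := hcritε _ hv
  have h2 : ⟪hε, M (hδ - hε)⟫_ℝ = 0 := by rw [← hM, real_inner_comm, h1]
  have hδδ : ⟪hδ, M hδ⟫_ℝ = ‖curl hδ‖ ^ 2 := formM_of_slice M curl dstar Rp hformM hδR
  have hsplit : ⟪hδ, M hδ⟫_ℝ = ⟪hε, M hε⟫_ℝ + ⟪hδ - hε, M (hδ - hε)⟫_ℝ := by
    have hx : hδ = hε + (hδ - hε) := by abel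
    conv_lhs => rw [hx]
    rw [map_add, inner_add_left, inner_add_right, inner_add_right, h1, h2]
    ring
  have key : ⟪hδ - hε, M (hδ - hε)⟫_ℝ = 0 := by linarith
  exact sub_eq_zero.mp (hdef _ hv key)

/-- **The hypothesis `h2118` of `…B6GaussianIdentity2119.inner_integral_2119` / `eq2119` and of `…B6Repr2129`, DISCHARGED
by the printed route (2.116)–(2.117):** for operators `H_j^{exp}` (`Hε`, the translation of (2.113): `hcritε`) and `H_j^{δ}`
(`Hδ`, Sect. D of [4]: `R∂*H_jB = 0`, `∂H_jB ⊥ ∂(slice)`, same fibre `Q_jH_j^{δ}B = Q_jH_j^{exp}B`) and `Δ_j` with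
`⟨B,Δ_jB⟩ = ⟨∂H_jB,∂H_jB⟩` ([4] (1.65), `h165`): `⟨H_jB,(Δ−∂P_j∂*)H_jB⟩ = ⟨B,Δ_jB⟩` for every `B` (*"the quadratic forms are
equal to ⟨B, Δ_jB⟩ given by (1.66)"*).  Data as in `forms_eq`, `Z̃_j ≠ 0`. [cite: Balaban1984PropagatorsII, (2.118) p.243] -/
theorem h2118_of_fp {Bs : Type*} [NormedAddCommGroup Bs] [InnerProductSpace ℝ Bs]
    (μS : Measure S) (ν : Measure N) (μ' : Measure N') [μS.IsAddHaarMeasure]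
    [ν.IsAddHaarMeasure] [μ'.IsAddHaarMeasure] (e : (S × N) ≃L[ℝ] N') (ι : N' →ₗ[ℝ] A) (σ : S → A)
    (dN : N →ₗ[ℝ] A) (he : ∀ m l, ι (e (m, l)) = σ m - dN l) (M : A →ₗ[ℝ] A) (Q : A →ₗ[ℝ] W)
    (curl : A →ₗ[ℝ] T) (dstar : A →ₗ[ℝ] V) (Rp : V →ₗ[ℝ] V) (D : N →ₗ[ℝ] V) (K : Submodule ℝ V)
    [K.HasOrthogonalProjection] (hK : LinearMap.range D = K) (hR : ∀ g, Rp g = K.starProjection g)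
    (hM : ∀ x y : A, ⟪M x, y⟫_ℝ = ⟪x, M y⟫_ℝ)
    (hformM : ∀ v, ⟪v, M v⟫_ℝ = ‖curl v‖ ^ 2 + ⟪dstar v, Rp (dstar v)⟫_ℝ) (hι : ∀ n, Q (ι n) = 0)
    (hιsurj : ∀ v : A, Q v = 0 → ∃ n : N', ι n = v)
    (hcurl : ∀ l, curl (dN l) = 0) (hD : ∀ l, dstar (dN l) = D l) (hσ : ∀ m, Rp (dstar (σ m)) = 0)
    (Hε Hδ : Bs →ₗ[ℝ] A) (Δj : Bs →ₗ[ℝ] Bs) (hQH : ∀ b, Q (Hδ b) = Q (Hε b))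
    (hcritε : ∀ (b : Bs) (v : A), Q v = 0 → ⟪v, M (Hε b)⟫_ℝ = 0) (hδR : ∀ b, Rp (dstar (Hδ b)) = 0)
    (hcritδ : ∀ b m, ⟪curl (σ m), curl (Hδ b)⟫_ℝ = 0) (h165 : ∀ b, ⟪b, Δj b⟫_ℝ = ‖curl (Hδ b)‖ ^ 2)
    (hZ : ∫ n, Real.exp (-(1 / 2) * ⟪ι n, M (ι n)⟫_ℝ) ∂μ' ≠ 0) (b : Bs) :
    ⟪Hε b, M (Hε b)⟫_ℝ = ⟪b, Δj b⟫_ℝ := by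
  have hfib : ∃ n₀ : N', ι n₀ = Hδ b - Hε b := hιsurj _ (by rw [map_sub, hQH, sub_self])
  rw [h165]
  exact forms_eq μS ν μ' e ι σ dN he M Q curl dstar Rp D K hK hR hM hformM hι hcurl hD hσ (hcritε b) (hδR b)
    (hcritδ b) hfib hZ

end Fibre

/-! ## §4  Discharging the data: the coordinates of the fibre exist; `Z̃_j > 0`; the fibre `ker Q_j` itself -/

section Discharge

variable {V A W T N : Type*} [NormedAddCommGroup V] [InnerProductSpace ℝ V]
  [NormedAddCommGroup A] [InnerProductSpace ℝ A] [FiniteDimensional ℝ A] [MeasurableSpace A] [BorelSpace A]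
  [NormedAddCommGroup W] [InnerProductSpace ℝ W] [NormedAddCommGroup T] [InnerProductSpace ℝ T]
  [NormedAddCommGroup N] [NormedSpace ℝ N] [FiniteDimensional ℝ N]

omit [MeasurableSpace A] [BorelSpace A] in
/-- **The Faddeev–Popov coordinates of the fibre directions exist:** `{Q_jA = 0} ≅ ({Q_j· = 0} ∩ {R∂*· = 0}) × N(Q′)`,
`(m, λ′) ↦ m − ∂λ′` — because `δ_R(R∂*A + Δλ′)` has exactly one zero for every `A` (`existsUnique_229`: Δ injective on
`N(Q′)` with range `ΔN(Q′)`) and the gauge orbit stays in the fibre (`Q_j∂λ′ = 0`, p. 227 *"QA^{λ′} = QA − ∂₁Q′λ′ = QA"*).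
[cite: Balaban1984PropagatorsII, (2.116)–(2.117) p.243] -/
theorem exists_fibreSliceEquiv (Q : A →ₗ[ℝ] W) (dstar : A →ₗ[ℝ] V) (Rp : V →ₗ[ℝ] V) (D : N →ₗ[ℝ] V)
    (dN : N →ₗ[ℝ] A) (K : Submodule ℝ V) [K.HasOrthogonalProjection] (hK : LinearMap.range D = K)
    (hR : ∀ g, Rp g = K.starProjection g) (hQ : ∀ l, Q (dN l) = 0) (hD : ∀ l, dstar (dN l) = D l)
    (hDinj : Function.Injective D) :
    ∃ e : (↥(LinearMap.ker Q ⊓ LinearMap.ker (Rp ∘ₗ dstar)) × N) ≃L[ℝ] ↥(LinearMap.ker Q),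
      ∀ m l, ((e (m, l) : ↥(LinearMap.ker Q)) : A) = (m : A) - dN l := by
  set S₀ := LinearMap.ker Q ⊓ LinearMap.ker (Rp ∘ₗ dstar) with hS₀
  let F : (↥S₀ × N) →ₗ[ℝ] A := S₀.subtype ∘ₗ LinearMap.fst ℝ (↥S₀) N - dN ∘ₗ LinearMap.snd ℝ (↥S₀) N
  have hF : ∀ (m : ↥S₀) (l : N), F (m, l) = (m : A) - dN l := fun m l => rfl
  have hFker : ∀ p : ↥S₀ × N, F p ∈ LinearMap.ker Q := by
    rintro ⟨m, l⟩
    rw [hF, LinearMap.mem_ker, map_sub, hQ, sub_zero]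
    exact (Submodule.mem_inf.mp m.2).1
  let E : (↥S₀ × N) →ₗ[ℝ] ↥(LinearMap.ker Q) := LinearMap.codRestrict (LinearMap.ker Q) F hFker
  have hE : ∀ (m : ↥S₀) (l : N), ((E (m, l) : ↥(LinearMap.ker Q)) : A) = (m : A) - dN l := fun m l => rfl
  have hinj : Function.Injective E := by
    rw [← LinearMap.ker_eq_bot, LinearMap.ker_eq_bot']
    rintro ⟨m, l⟩ h
    have h' : (m : A) - dN l = 0 := by
      have := congrArg (fun x : ↥(LinearMap.ker Q) => (x : A)) h
      simpa [hE] using this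
    have hm : Rp (dstar (m : A)) = 0 := (Submodule.mem_inf.mp m.2).2
    rw [sub_eq_zero] at h'
    have hl : D l = 0 := by
      rw [h', hD, R_apply_D D K hK Rp hR] at hm; exact hm
    have hl0 : l = 0 := hDinj (by rw [hl, map_zero])
    have hm0 : (m : A) = 0 := by rw [h', hl0, map_zero]
    ext <;> simp [hl0, hm0]
  have hsurj : Function.Surjective E := by
    rintro ⟨v, hv⟩
    obtain ⟨l, hl, -⟩ := existsUnique_229 D K hK Rp hR hDinj (dstar v)
    have hmem : v + dN l ∈ S₀ := by
      refine Submodule.mem_inf.mpr ⟨?_, ?_⟩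
      · rw [LinearMap.mem_ker, map_add, hQ, add_zero]; exact hv
      · show (Rp ∘ₗ dstar) (v + dN l) = 0
        rw [LinearMap.comp_apply, map_add, map_add, hD, R_apply_D D K hK Rp hR]
        exact hl
    refine ⟨(⟨v + dN l, hmem⟩, l), ?_⟩
    apply Subtype.ext
    rw [hE]
    simp
  exact ⟨(LinearEquiv.ofBijective E ⟨hinj, hsurj⟩).toContinuousLinearEquiv, fun m l => rfl⟩

/-- **`Z̃_j > 0`:** if `⟨A,(Δ−∂P_j∂*)A⟩ ≥ γ‖A‖²` on `{Q_jA = 0}` (`γ > 0`; by (2.118)/[4] (1.67) the form is positive there),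
the constrained Gaussian normalisation `Z̃_j = ∫dAδ(Q_jA) e^{−½⟨A,(Δ−∂P_j∂*)A⟩}` is a convergent, strictly positive
integral for every additive Haar (Lebesgue) measure on the fibre `ker Q_j` (`…B6Eq230GaussianRoute.Z_pos` on the
subspace). [cite: Balaban1984PropagatorsII, (2.116) p.243] -/
theorem Ztilde_pos (Q : A →ₗ[ℝ] W) (μ' : Measure ↥(LinearMap.ker Q)) [μ'.IsAddHaarMeasure] (M : A →ₗ[ℝ] A)
    {γ : ℝ} (hγ : 0 < γ) (hpos : ∀ v : A, Q v = 0 → γ * ‖v‖ ^ 2 ≤ ⟪v, M v⟫_ℝ) :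
    0 < ∫ v, Real.exp (-(1 / 2) * ⟪(v : A), M v⟫_ℝ) ∂μ' := by
  let M' : ↥(LinearMap.ker Q) →ₗ[ℝ] ↥(LinearMap.ker Q) :=
    (LinearMap.adjoint (LinearMap.ker Q).subtype) ∘ₗ M ∘ₗ (LinearMap.ker Q).subtype
  have hM' : ∀ v : ↥(LinearMap.ker Q), ⟪v, M' v⟫_ℝ = ⟪(v : A), M v⟫_ℝ := by
    intro v
    show ⟪v, LinearMap.adjoint (LinearMap.ker Q).subtype (M ((LinearMap.ker Q).subtype v))⟫_ℝ = _
    rw [LinearMap.adjoint_inner_right]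
    rfl
  have hpos' : ∀ v : ↥(LinearMap.ker Q), γ * ‖v‖ ^ 2 ≤ ⟪v, M' v⟫_ℝ := by
    intro v
    rw [hM', Submodule.coe_norm]
    exact hpos _ (LinearMap.mem_ker.mp v.2)
  have h := (B6Eq230GaussianRoute.Z_pos μ' M' hγ hpos').2
  simp_rw [hM'] at h
  exact h

/-- **The quadratic forms are equal — with the Faddeev–Popov data DISCHARGED.**  The fibre `{Q_jA = B}` is `ker Q_j + hε`
with ANY additive Haar (Lebesgue) measure `μ′` ("`dAδ(Q_jA − B)`"); hypotheses = the printed structure only: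
`⟨A,(Δ−∂P_j∂*)A⟩ = ‖∂A‖² + ⟨∂*A,R∂*A⟩` symmetric, `R` the orthogonal projection onto `ΔN(Q′)` ((2.10)), `Δ = ∂*∂`
injective on `N(Q′)` ((2.11)), `∂∂λ = 0`, `Q_j∂λ = 0` ((2.6)–(2.7)); `hε = H_j^{exp}B` (`hcritε`), `hδ = H_j^{δ}B` on the same
fibre (`R∂*hδ = 0`, *"⟨∂A′,∂H_kB⟩ = 0 on {Q_kA′ = 0, R∂*A′ = 0}"*), and `Z̃_j ≠ 0` (`Ztilde_pos`).  Conclusion: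
`⟨H_j^{exp}B,(Δ−∂P_j∂*)H_j^{exp}B⟩ = ‖∂H_j^{δ}B‖²`; the slice/orbit Lebesgue measures are chosen internally (they cancel).
[cite: Balaban1984PropagatorsII, (2.117)–(2.118) p.243] -/
theorem forms_eq_of_fp (Q : A →ₗ[ℝ] W) (μ' : Measure ↥(LinearMap.ker Q)) [μ'.IsAddHaarMeasure]
    (M : A →ₗ[ℝ] A) (curl : A →ₗ[ℝ] T) (dstar : A →ₗ[ℝ] V) (Rp : V →ₗ[ℝ] V) (D : N →ₗ[ℝ] V)
    (dN : N →ₗ[ℝ] A) (K : Submodule ℝ V) [K.HasOrthogonalProjection] (hK : LinearMap.range D = K)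
    (hR : ∀ g, Rp g = K.starProjection g) (hM : ∀ x y : A, ⟪M x, y⟫_ℝ = ⟪x, M y⟫_ℝ)
    (hformM : ∀ v, ⟪v, M v⟫_ℝ = ‖curl v‖ ^ 2 + ⟪dstar v, Rp (dstar v)⟫_ℝ)
    (hcurl : ∀ l, curl (dN l) = 0) (hQ : ∀ l, Q (dN l) = 0) (hD : ∀ l, dstar (dN l) = D l)
    (hDinj : Function.Injective D) {hε hδ : A} (hQh : Q hδ = Q hε)
    (hcritε : ∀ v : A, Q v = 0 → ⟪v, M hε⟫_ℝ = 0) (hδR : Rp (dstar hδ) = 0)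
    (hcritδ : ∀ v : A, Q v = 0 → Rp (dstar v) = 0 → ⟪curl v, curl hδ⟫_ℝ = 0)
    (hZ : ∫ v, Real.exp (-(1 / 2) * ⟪(v : A), M v⟫_ℝ) ∂μ' ≠ 0) :
    ⟪hε, M hε⟫_ℝ = ‖curl hδ‖ ^ 2 := by
  borelize N
  obtain ⟨e, he⟩ := exists_fibreSliceEquiv Q dstar Rp D dN K hK hR hQ hD hDinj
  have hι : ∀ n : ↥(LinearMap.ker Q), Q ((LinearMap.ker Q).subtype n) = 0 :=
    fun n => LinearMap.mem_ker.mp n.2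
  have hσ : ∀ m : ↥(LinearMap.ker Q ⊓ LinearMap.ker (Rp ∘ₗ dstar)), Rp (dstar (m : A)) = 0 :=
    fun m => (Submodule.mem_inf.mp m.2).2
  have hcritδ' : ∀ m : ↥(LinearMap.ker Q ⊓ LinearMap.ker (Rp ∘ₗ dstar)), ⟪curl (m : A), curl hδ⟫_ℝ = 0 :=
    fun m => hcritδ _ (LinearMap.mem_ker.mp (Submodule.mem_inf.mp m.2).1) (hσ m)
  have hfib : ∃ n₀ : ↥(LinearMap.ker Q), (LinearMap.ker Q).subtype n₀ = hδ - hε :=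
    ⟨⟨hδ - hε, by rw [LinearMap.mem_ker, map_sub, hQh, sub_self]⟩, rfl⟩
  have hZ' : ∫ n, Real.exp (-(1 / 2) * ⟪(LinearMap.ker Q).subtype n, M ((LinearMap.ker Q).subtype n)⟫_ℝ) ∂μ' ≠ 0 :=
    hZ
  exact forms_eq (Measure.addHaar) (Measure.addHaar) μ' e (LinearMap.ker Q).subtype
    (fun m : ↥(LinearMap.ker Q ⊓ LinearMap.ker (Rp ∘ₗ dstar)) => (m : A)) dN
    he M Q curl dstar Rp D K hK hR hM hformM hι hcurl hD hσ hcritε hδR hcritδ' hfib hZ'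

/-- **`h2118` on the fibre `ker Q_j`, data discharged:** for `H_j^{exp}` (`hcritε`), `H_j^{δ}` (Sect. D of [4]: `Q_jH_j^{δ} =
Q_jH_j^{exp}`, `R∂*H_j^{δ} = 0`, `∂H_j^{δ}B ⊥ ∂{Q_j· = 0, R∂*· = 0}`) and `Δ_j` with `⟨B,Δ_jB⟩ = ‖∂H_j^{δ}B‖²` ((1.65)):
`∀ B, ⟨H_j^{exp}B,(Δ−∂P_j∂*)H_j^{exp}B⟩ = ⟨B,Δ_jB⟩` — the hypothesis of `…B6GaussianIdentity2119.eq2119` in its own letters.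
[cite: Balaban1984PropagatorsII, (2.118) p.243] -/
theorem h2118_of_fp_ker {Bs : Type*} [NormedAddCommGroup Bs] [InnerProductSpace ℝ Bs]
    (Q : A →ₗ[ℝ] W) (μ' : Measure ↥(LinearMap.ker Q)) [μ'.IsAddHaarMeasure]
    (M : A →ₗ[ℝ] A) (curl : A →ₗ[ℝ] T) (dstar : A →ₗ[ℝ] V) (Rp : V →ₗ[ℝ] V) (D : N →ₗ[ℝ] V)
    (dN : N →ₗ[ℝ] A) (K : Submodule ℝ V) [K.HasOrthogonalProjection] (hK : LinearMap.range D = K)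
    (hR : ∀ g, Rp g = K.starProjection g) (hM : ∀ x y : A, ⟪M x, y⟫_ℝ = ⟪x, M y⟫_ℝ)
    (hformM : ∀ v, ⟪v, M v⟫_ℝ = ‖curl v‖ ^ 2 + ⟪dstar v, Rp (dstar v)⟫_ℝ)
    (hcurl : ∀ l, curl (dN l) = 0) (hQ : ∀ l, Q (dN l) = 0) (hD : ∀ l, dstar (dN l) = D l)
    (hDinj : Function.Injective D) (Hε Hδ : Bs →ₗ[ℝ] A) (Δj : Bs →ₗ[ℝ] Bs)
    (hQH : ∀ b, Q (Hδ b) = Q (Hε b)) (hcritε : ∀ (b : Bs) (v : A), Q v = 0 → ⟪v, M (Hε b)⟫_ℝ = 0)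
    (hδR : ∀ b, Rp (dstar (Hδ b)) = 0)
    (hcritδ : ∀ (b : Bs) (v : A), Q v = 0 → Rp (dstar v) = 0 → ⟪curl v, curl (Hδ b)⟫_ℝ = 0)
    (h165 : ∀ b, ⟪b, Δj b⟫_ℝ = ‖curl (Hδ b)‖ ^ 2)
    (hZ : ∫ v, Real.exp (-(1 / 2) * ⟪(v : A), M v⟫_ℝ) ∂μ' ≠ 0) (b : Bs) :
    ⟪Hε b, M (Hε b)⟫_ℝ = ⟪b, Δj b⟫_ℝ := by
  rw [h165]
  exact forms_eq_of_fp Q μ' M curl dstar Rp D dN K hK hR hM hformM hcurl hQ hD hDinj (hQH b) (hcritε b) (hδR b)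
    (hcritδ b) hZ

end Discharge

end Literature.MathematicalPhysics.QuantumFieldTheory.Balaban1983to89.B6Eq2117FaddeevPopov

end
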